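import Literature.AlgebraicGeometry.Shioda1982.PicardNumberTwentyFourPrime
import Literature.AlgebraicGeometry.Shioda1982.ExceptionalQuadruplesSweepTwoHundredSixtyFour
import Literature.AlgebraicGeometry.Shioda1982.ExceptionalQuadruplesSweepThreeHundredTwelve
import HarnessLib

/-!
# Shioda 1982 / Meyer–Neutsch 1981: the exceptional quadruples of the levels `24p` occur only at `48`, `72` and `120`

Topic `Literature/AlgebraicGeometry/Shioda1982`; a one-theorem companion of `PicardNumberTwentyFourPrime.lean`
(`exceptional_twentyFourPrime_ne_seven`: an exceptional quadruple — Hodge, four entries, no pair, `gcd = 1`, not standard — of level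
`24p`, `p` prime, forces `p ∈ {2, 3, 5, 11, 13}`; the levels `48`, `72`, `120` are rows of Meyer–Neutsch's Tabelle 1, `p ≥ 17` is
excluded by the classification `classify_hodgeMultiset_twentyFourPrime`, `p = 7` by the kernel sweep at `168`) and of the kernel sweeps
`ExceptionalQuadruplesSweepTwoHundredSixtyFour(PartOne).lean` (`N = 264 = 24·11`) and `ExceptionalQuadruplesSweepThreeHundredTwelve(PartOne/PartTwo).lean`
(`N = 312 = 24·13`), which remove the two residual primes: **`exceptional_twentyFourPrime_sharp`** — an exceptional quadruple of
level `24p` forces `p ∈ {2, 3, 5}`. THEOREM only (no definition, no named fact). Sources: [MeyerNeutsch1981Fermatquadrupel, Tabelle 1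
p. 54] (rows `48`, `72`, `120`; no rows `168, 264, 312`; "alle Fermatquadrupel für N ≤ 614 ermittelt", §2 p. 53),
[Shioda1982PicardFermat, Prop. 4 (Q′) p. 729 and table p. 727], [Aoki1983, Thm. C] (no exceptional element above `180`;
computer-assisted there, here the two instances are kernel statements).

HONEST FRAMING (cell `pub-hfermat`): explicit algebraic cycles for specific Hodge classes on Fermat/Delsarte varieties; residual open
instances listed; no claim on general Hodge. (Surface classes are algebraic by Lefschetz (1,1); this file only combines tree theorems.)

## References
* [MeyerNeutsch1981Fermatquadrupel] W. Meyer, W. Neutsch, *Fermatquadrupel*, Math. Ann. 256 (1981) 51–62, §2 p. 53, Tabelle 1 p. 54.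
* [Shioda1982PicardFermat] T. Shioda, J. Fac. Sci. Univ. Tokyo IA 28 (1982) 725–734, Prop. 4 (Q′) p. 729, table p. 727.
* [Aoki1983] N. Aoki, Math. Ann. 266 (1983) 23–54, Thm. C.
-/

namespace Literature.AlgebraicGeometry.Shioda1982

open Literature.AlgebraicGeometry.HodgeTheory

/-- **An exceptional quadruple of level `24p`, `p` prime, forces `p ∈ {2, 3, 5}`** — the residual primes `p = 11, 13` of
`exceptional_twentyFourPrime_ne_seven` (levels `264`, `312`: above Shioda's table `N ≤ 180`, below the range `p ≥ 17` of the
classification; no rows of Tabelle 1, which is complete for `N ≤ 614`) are excluded by the kernel sweeps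
`not_isExceptionalQuadruple_twoHundredSixtyFour` and `not_isExceptionalQuadruple_threeHundredTwelve`; so an exceptional quadruple of
level `24p` can only occur at the levels `48`, `72` and `120` (rows of Tabelle 1).
[cite: MeyerNeutsch1981Fermatquadrupel, Tabelle 1 p. 54 (rows 48, 72, 120; no rows 168, 264, 312) and §2 p. 53]
[cite: Shioda1982PicardFermat, Prop. 4 (Q′) p. 729 and table p. 727] [cite: Aoki1983, Thm. C] -/
theorem exceptional_twentyFourPrime_sharp {m p : ℕ} [NeZero m] (hm : m = 24 * p) (hp : p.Prime) {s : Multiset (ZMod m)}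
    (hs : IsExceptionalQuadruple m s) : p = 2 ∨ p = 3 ∨ p = 5 := by
  rcases exceptional_twentyFourPrime_ne_seven hm hp hs with h | h | h | h | h
  · exact Or.inl h
  · exact Or.inr (Or.inl h)
  · exact Or.inr (Or.inr h)
  · exfalso
    subst h
    subst hm
    exact not_isExceptionalQuadruple_twoHundredSixtyFour s hs
  · exfalso
    subst h
    subst hm
    exact not_isExceptionalQuadruple_threeHundredTwelve s hs

end Literature.AlgebraicGeometry.Shioda1982
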